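import Mathlib
import HarnessLib
import Summits.HubbardSuperconductivity.HubbardSuperconductivity.Theorems.KLProgrammeC4aPartnerBandLevelRate
import Summits.HubbardSuperconductivity.HubbardSuperconductivity.Theorems.KLProgrammeC4aPartnerBandCooperChord
import Summits.HubbardSuperconductivity.HubbardSuperconductivity.Theorems.KLProgrammeC4aTransversalityGaussLaw
import Summits.HubbardSuperconductivity.HubbardSuperconductivity.Theorems.KLProgrammeC4aPartnerBandTangencyDefect

/-!
# Route `KLProgramme` — crux C4a, S3 brick (B4) «(B4)-UMK1», (P2) TRUE HALF «(P2)-TRANSVERSAL»: the CONFIGURATION RATE of the partner band (`∂_ϑ ē`), its Gauss-law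
# floor keyed on the partner's chart angle, the monotone drift of the fold value in `ϑ` (no implicit function), and the same-direction exclusion on umklapp sheets

Cell `gate-hubbard-kl`, seat hubbard-kl-k3c3-p3 (g28; row «implicit-function / monotonicity route for μ(n)»).  Located brick for the (C)-closer lane hubbard-kl-c4a-1
(stub (C) `stub_twoLeg_curvature` of `KLRegimeEngineV17F2`, stmt-HubbardSuperconductivity-20437), memo HOME/hubbard-kl-k3c3-p3/U1-CAUSTIC-SUP.md §3–§4 and
B4-UMK1-DESIGN.md §4 (d)/§6 (P2).  The ϑ-layer `…C4aCausticAngleLayer` needs `|δ₀(ϑ)| ≳ |ϑ − c|` across a zero `c` of the caustic offset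
`δ₀(ϑ) = min_φ e_K(S(ϑ) − v − Φ(0,φ+θ))`, `S(ϑ) = Φ(0,θ) + Φ(ρ,ϑ+θ)` (`= pairSumPath μ K ρ ϑ θ 0`).  WHAT IS TRUE (this file) and what is NOT (memo §3: at the
antipodal-umklapp configurations `k + 3q′ ∈ 2πℤ²∖0` the offset has a pre-side DOUBLE zero — (P2) as designed is false there):
* §1 (abstract, the `fold_value_drift` pattern in a parameter with SIGNED rates) **`min_value_increment`**: minimisers `v*(t) ∈ W`, rates
  `κ₁(t−t′) ≤ f t v − f t′ v ≤ κ₂(t−t′)` on `T × W` ⟹ the minimum has the same rates; **`abs_min_value_sub_ge`** (`0 < κ ≤ κ₁` or `κ₂ ≤ −κ` ⟹ `κ|t−t′| ≤ |m(t) − m(t′)|`),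
  **`abs_min_value_ge_of_zero`** (`m(c) = 0` ⟹ `κ|t − c| ≤ |m(t)|`) — the `hF` geometry of the caustic angle layer, by monotonicity only;
* §2 **`hasDerivAt_partnerBand_config`**: `∂_ϑ e_K(S(ϑ) − X₀ − Φ(e,α)) = De_K(S(ϑ) − X₀ − Φ(e,α))[∂_sΦ(ρ,ϑ+θ)]` (any fixed shift `X₀`, e.g. a period `2πm`);
* §3 **`abs_config_rate_ge_of_chartPoint`**: if the partner is a chart point up to a period, `P = Φ(ē,ψ) + v` (`…C4aPartnerBandChartPoint`), then by the Gauss law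
  (`…C4aTransversalityGaussLaw`) `|De_K(P)[∂_sΦ(ρ,χ)]| ≥ (2/π)(Dt−2A)u_min·((u_min·w/(4+2A))·min(‖ψ−χ‖_𝕋, ‖ψ−χ−π‖_𝕋) − πKc|ē−ρ|/(Dt−2A)²)` — SHEET-UNIFORM
  (`De_K` is periodic): the configuration rate degenerates only when the partner's chart angle is `±χ (mod π)`, `χ = ϑ + θ` the angle of `q′`;
* §4 **`partnerBand_config_rate_window`**: a two-sided bound `κ₁ ≤ De_K(…)[∂_sΦ(ρ,s+θ)] ≤ κ₂` on a ϑ-window gives the signed increments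
  `κ₁(ϑ−ϑ′) ≤ ē(ϑ) − ē(ϑ′) ≤ κ₂(ϑ−ϑ′)` — the `hrate` of §1 for the actual partner band;
* §5 **`norm_sub_sub_le_caustic_add_two`** (`‖k − q′ − v‖ ≤ ‖P − p − v‖ + 2‖p − q′‖` for `P = k + q′ − p`) and **`lt_caustic_dist_add_two_norm_sub`**: on a sheet `m ≠ 0`,
  `3/5 < ‖P − p − 2πm‖ + 2‖p − q′‖` for `k = Φ(0,θ)`, `q′ = Φ(ρ,ϑ+θ)`, any tube point `p = Φ(e,α)`, `P = S − p` — an umklapp fold point (`‖P − p − 2πm‖` small) is NEVER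
  `q′`-directed (`‖p − q′‖` small): the SAME-DIRECTION half of the degenerate alternative of §3 is excluded by part 2's 3/5 margin.  (The antipodal half is not.)
Sizes binder shape; pure calculus/bookkeeping on landed objects; nothing about the model's sizes; nothing asserts (C), K3 or superconductivity.
References: BGM 2003 §7.1 Lemma 7.1 (A1.9) [cite: BenfattoGiulianiMastropietro2003]; FST II CPAM 51 (1998) §3 [cite: FeldmanSalmhoferTrubowitz1998].
-/

noncomputable section

namespace Summit.HubbardSuperconductivity.HubbardSuperconductivity.Theorems.C4a

set_option linter.dupNamespace false -- summit = problem name (single-conjunct summit), D-0017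

open Real Set
open Literature.MathematicalPhysics.QuantumLattice Literature.MathematicalPhysics.QuantumLattice.BandSectorCounting
open Literature.MathematicalPhysics.QuantumLattice.FermiRG
open Summit.HubbardSuperconductivity.HubbardSuperconductivity.Theorems.KLRegimeSplit
open Summit.HubbardSuperconductivity.HubbardSuperconductivity.Theorems.DispersionFlow
open Summit.HubbardSuperconductivity.HubbardSuperconductivity.Theorems.PerturbedFermiCurve

/-! ## §1 Monotone drift of a window minimum under signed parameter rates -/

/-- **THE MINIMUM INHERITS SIGNED RATES** (monotonicity of the minimum; no implicit function).  `f : ℝ → ℝ → ℝ`, parameter set `T`, window `W`; at every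
parameter a minimiser `v*(t) ∈ W` (`f t (v* t) ≤ f t v` on `W`); rates `κ₁(t − t′) ≤ f t v − f t′ v ≤ κ₂(t − t′)` for `t′ ≤ t` in `T`, `v ∈ W`.  THEN
`κ₁(t − t′) ≤ f t (v* t) − f t′ (v* t′) ≤ κ₂(t − t′)`. -/
theorem min_value_increment {f : ℝ → ℝ → ℝ} {vs : ℝ → ℝ} {T W : Set ℝ} {κ₁ κ₂ : ℝ}
    (hvs : ∀ t ∈ T, vs t ∈ W) (hmin : ∀ t ∈ T, ∀ v ∈ W, f t (vs t) ≤ f t v)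
    (hrate : ∀ t ∈ T, ∀ t' ∈ T, t' ≤ t → ∀ v ∈ W, κ₁ * (t - t') ≤ f t v - f t' v ∧ f t v - f t' v ≤ κ₂ * (t - t'))
    {t t' : ℝ} (ht : t ∈ T) (ht' : t' ∈ T) (htt' : t' ≤ t) :
    κ₁ * (t - t') ≤ f t (vs t) - f t' (vs t') ∧ f t (vs t) - f t' (vs t') ≤ κ₂ * (t - t') := by
  constructor
  · have h1 := (hrate t ht t' ht' htt' (vs t) (hvs t ht)).1
    have h2 := hmin t' ht' (vs t) (hvs t ht)
    linarith
  · have h1 := (hrate t ht t' ht' htt' (vs t') (hvs t' ht')).2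
    have h2 := hmin t ht (vs t') (hvs t' ht')
    linarith

/-- **Bi-Lipschitz from below**: under the hypotheses of `min_value_increment`, if the rates have a sign — `0 < κ ≤ κ₁` (increasing) or `κ₂ ≤ −κ < 0` (decreasing) —
then `κ·|t − t′| ≤ |f t (v* t) − f t′ (v* t′)|` for all `t, t′ ∈ T` (trivial for `κ ≤ 0`). -/
theorem abs_min_value_sub_ge {f : ℝ → ℝ → ℝ} {vs : ℝ → ℝ} {T W : Set ℝ} {κ₁ κ₂ κ : ℝ}
    (hvs : ∀ t ∈ T, vs t ∈ W) (hmin : ∀ t ∈ T, ∀ v ∈ W, f t (vs t) ≤ f t v)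
    (hrate : ∀ t ∈ T, ∀ t' ∈ T, t' ≤ t → ∀ v ∈ W, κ₁ * (t - t') ≤ f t v - f t' v ∧ f t v - f t' v ≤ κ₂ * (t - t'))
    (hsign : κ ≤ κ₁ ∨ κ₂ ≤ -κ) {t t' : ℝ} (ht : t ∈ T) (ht' : t' ∈ T) :
    κ * |t - t'| ≤ |f t (vs t) - f t' (vs t')| := by
  rcases le_total t' t with h | h
  · have hI := min_value_increment hvs hmin hrate ht ht' h
    rw [abs_of_nonneg (sub_nonneg.2 h)]
    rcases hsign with hs | hs
    · have h1 : κ * (t - t') ≤ f t (vs t) - f t' (vs t') := by nlinarith [hI.1, sub_nonneg.2 h]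
      exact h1.trans (le_abs_self _)
    · have h1 : f t (vs t) - f t' (vs t') ≤ -(κ * (t - t')) := by nlinarith [hI.2, sub_nonneg.2 h]
      have h2 : κ * (t - t') ≤ -(f t (vs t) - f t' (vs t')) := by linarith
      exact h2.trans (neg_le_abs _)
  · have hI := min_value_increment hvs hmin hrate ht' ht h
    rw [abs_sub_comm t t', abs_of_nonneg (sub_nonneg.2 h), abs_sub_comm]
    rcases hsign with hs | hs
    · have h1 : κ * (t' - t) ≤ f t' (vs t') - f t (vs t) := by nlinarith [hI.1, sub_nonneg.2 h]
      exact h1.trans (le_abs_self _)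
    · have h1 : f t' (vs t') - f t (vs t) ≤ -(κ * (t' - t)) := by nlinarith [hI.2, sub_nonneg.2 h]
      have h2 : κ * (t' - t) ≤ -(f t' (vs t') - f t (vs t)) := by linarith
      exact h2.trans (neg_le_abs _)

/-- **ACROSS A TRANSVERSAL ZERO**: if moreover the minimum vanishes at `c ∈ T`, then `κ·|t − c| ≤ |f t (v* t)|` for `t ∈ T` — the `|δ₀(ϑ)| ≳ |ϑ − c|` geometry of
`…C4aCausticAngleLayer.intervalIntegral_caustic_window_le`. -/
theorem abs_min_value_ge_of_zero {f : ℝ → ℝ → ℝ} {vs : ℝ → ℝ} {T W : Set ℝ} {κ₁ κ₂ κ : ℝ}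
    (hvs : ∀ t ∈ T, vs t ∈ W) (hmin : ∀ t ∈ T, ∀ v ∈ W, f t (vs t) ≤ f t v)
    (hrate : ∀ t ∈ T, ∀ t' ∈ T, t' ≤ t → ∀ v ∈ W, κ₁ * (t - t') ≤ f t v - f t' v ∧ f t v - f t' v ≤ κ₂ * (t - t'))
    (hsign : κ ≤ κ₁ ∨ κ₂ ≤ -κ) {c : ℝ} (hc : c ∈ T) (hzero : f c (vs c) = 0) {t : ℝ} (ht : t ∈ T) :
    κ * |t - c| ≤ |f t (vs t)| := by
  have h := abs_min_value_sub_ge hvs hmin hrate hsign ht hc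
  rwa [hzero, sub_zero] at h

/-! ## §2 The configuration rate of the partner band -/

section Sizes

variable {K : TrigPolyC4v} {A : ℝ} (hA : ∀ p : Momentum, ∀ j ≤ 2, ‖iteratedFDeriv ℝ j (frameShift K) p‖ ≤ A)
  (hd : klCurveD ≤ (bandBounds (show (-4 : ℝ) < -1.1 by norm_num) (show (-1.1 : ℝ) ≤ -0.1 by norm_num)
    (show (-0.1 : ℝ) < 0 by norm_num)).Dtmin - 2 * A)
  {μ r : ℝ} (hlo : (-1.1 : ℝ) < μ - r - A) (hhi : μ + r + A < -0.1)
include hA hd hlo hhi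

/-- **THE CONFIGURATION RATE**: for `|ρ| < r`, a fixed shift `X₀` (a period `2πm`, say), a loop point `Φ(e,α)` and base angle `θ`,
`∂_ϑ e_K(S(ϑ) − X₀ − Φ(e,α)) = De_K(S(ϑ) − X₀ − Φ(e,α))[∂_sΦ(ρ,ϑ+θ)]`, `S(ϑ) = pairSumPath μ K ρ ϑ θ 0 = Φ(0,θ) + Φ(ρ,ϑ+θ)`. -/
theorem hasDerivAt_partnerBand_config (X₀ : Momentum) {ρ : ℝ} (hρ : |ρ| < r) (θ e α ϑ : ℝ) :
    HasDerivAt (fun t : ℝ => frameLevel μ K (pairSumPath μ K ρ t θ 0 - X₀ - levelPoint μ K e α))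
      (fderiv ℝ (frameLevel μ K) (pairSumPath μ K ρ ϑ θ 0 - X₀ - levelPoint μ K e α)
        (iteratedDeriv 1 (levelPoint μ K ρ) (ϑ + θ))) ϑ := by
  have hq : HasDerivAt (fun t : ℝ => levelPoint μ K ρ (t + θ)) (iteratedDeriv 1 (levelPoint μ K ρ) (ϑ + θ)) ϑ :=
    HasDerivAt.comp_add_const ϑ θ (hasDerivAt_levelPoint_angle hA hd hlo hhi hρ (ϑ + θ))
  have hS : HasDerivAt (fun t : ℝ => pairSumPath μ K ρ t θ 0 - X₀ - levelPoint μ K e α)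
      (iteratedDeriv 1 (levelPoint μ K ρ) (ϑ + θ)) ϑ := by
    have hfun : (fun t : ℝ => pairSumPath μ K ρ t θ 0 - X₀ - levelPoint μ K e α) =
        fun t => levelPoint μ K ρ (t + θ) + (levelPoint μ K 0 θ - X₀ - levelPoint μ K e α) := by
      funext t
      simp only [pairSumPath, add_zero]
      abel
    rw [hfun]
    exact hq.add_const _
  have hE : DifferentiableAt ℝ (frameLevel μ K) (pairSumPath μ K ρ ϑ θ 0 - X₀ - levelPoint μ K e α) :=
    ((EngineV8.contDiff_frameLevel μ K (n := 1)).differentiable one_ne_zero) _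
  exact hE.hasFDerivAt.comp_hasDerivAt ϑ hS

/-- The same as a `deriv` identity. -/
theorem deriv_partnerBand_config (X₀ : Momentum) {ρ : ℝ} (hρ : |ρ| < r) (θ e α ϑ : ℝ) :
    deriv (fun t : ℝ => frameLevel μ K (pairSumPath μ K ρ t θ 0 - X₀ - levelPoint μ K e α)) ϑ =
      fderiv ℝ (frameLevel μ K) (pairSumPath μ K ρ ϑ θ 0 - X₀ - levelPoint μ K e α) (iteratedDeriv 1 (levelPoint μ K ρ) (ϑ + θ)) :=
  (hasDerivAt_partnerBand_config hA hd hlo hhi X₀ hρ θ e α ϑ).deriv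

/-! ## §3 The Gauss-law floor keyed on the partner's chart angle (sheet-uniform) -/

/-- **CONFIGURATION-RATE FLOOR**: under `GeomConstants (frameLevel μ K) Kc r₀ g₀ w` (clause (i) of `FrameOK`), if the partner is a chart point up to a period of `e_K`,
`P = Φ(ē,ψ) + v`, `|ē| < r`, and `|ρ| < r`, `|ρ| < r₀`, then for every angle `χ`
`(2/π)(Dt−2A)u_min·((u_min·w/(4+2A))·min(‖ψ−χ‖_𝕋, ‖ψ−χ−π‖_𝕋) − πKc|ē−ρ|/(Dt−2A)²) ≤ |De_K(P)[∂_sΦ(ρ,χ)]|` — with `χ = ϑ + θ` this is the floor of the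
configuration rate of §2: it degenerates only when the partner's chart angle is `±(ϑ+θ) (mod π)`, whatever the sheet `v`. [cite: BenfattoGiulianiMastropietro2003, §7.1 Lemma 7.1 (A1.9)] -/
theorem abs_config_rate_ge_of_chartPoint {Kc r₀ g₀ w : ℝ} (hG : GeomConstants (frameLevel μ K) Kc r₀ g₀ w)
    {v : Momentum} (hv : ∀ q : Momentum, frameLevel μ K (q + v) = frameLevel μ K q)
    {P : Momentum} {ē ψ : ℝ} (hP : P = levelPoint μ K ē ψ + v) (hē : |ē| < r) {ρ : ℝ} (hρ : |ρ| < r) (hρ₀ : |ρ| < r₀) (χ : ℝ) :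
    2 / π * (((bandBounds (show (-4 : ℝ) < -1.1 by norm_num) (show (-1.1 : ℝ) ≤ -0.1 by norm_num) (show (-0.1 : ℝ) < 0 by norm_num)).Dtmin - 2 * A) *
        (bandBounds (show (-4 : ℝ) < -1.1 by norm_num) (show (-1.1 : ℝ) ≤ -0.1 by norm_num) (show (-0.1 : ℝ) < 0 by norm_num)).umin) *
      ((bandBounds (show (-4 : ℝ) < -1.1 by norm_num) (show (-1.1 : ℝ) ≤ -0.1 by norm_num) (show (-0.1 : ℝ) < 0 by norm_num)).umin * w /
            (4 + 2 * A) * min (torusDist (ψ - χ)) (torusDist (ψ - χ - π)) -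
        π * Kc * |ē - ρ| / ((bandBounds (show (-4 : ℝ) < -1.1 by norm_num) (show (-1.1 : ℝ) ≤ -0.1 by norm_num)
          (show (-0.1 : ℝ) < 0 by norm_num)).Dtmin - 2 * A) ^ 2) ≤
      |fderiv ℝ (frameLevel μ K) P (iteratedDeriv 1 (levelPoint μ K ρ) χ)| := by
  rw [hP, fderiv_frameLevel_add_period μ K hv]
  exact abs_fderiv_frameLevel_levelPoint_tangent_ge hA hd hlo hhi hG hē hρ hρ₀ ψ χ

/-! ## §4 A rate window gives signed increments of the partner band in `ϑ` -/

/-- **CONFIGURATION-RATE WINDOW**: if `κ₁ ≤ De_K(S(s) − X₀ − Φ(e,α))[∂_sΦ(ρ,s+θ)] ≤ κ₂` for all `s ∈ [ϑ′, ϑ]` (`|ρ| < r`), then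
`κ₁(ϑ − ϑ′) ≤ e_K(S(ϑ) − X₀ − Φ(e,α)) − e_K(S(ϑ′) − X₀ − Φ(e,α)) ≤ κ₂(ϑ − ϑ′)` — the `hrate` of `min_value_increment` for the actual partner band. -/
theorem partnerBand_config_rate_window (X₀ : Momentum) {ρ : ℝ} (hρ : |ρ| < r) (θ e α : ℝ) {ϑ' ϑ κ₁ κ₂ : ℝ} (hϑ : ϑ' ≤ ϑ)
    (hwin : ∀ s ∈ Icc ϑ' ϑ,
      κ₁ ≤ fderiv ℝ (frameLevel μ K) (pairSumPath μ K ρ s θ 0 - X₀ - levelPoint μ K e α) (iteratedDeriv 1 (levelPoint μ K ρ) (s + θ)) ∧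
        fderiv ℝ (frameLevel μ K) (pairSumPath μ K ρ s θ 0 - X₀ - levelPoint μ K e α) (iteratedDeriv 1 (levelPoint μ K ρ) (s + θ)) ≤ κ₂) :
    κ₁ * (ϑ - ϑ') ≤ frameLevel μ K (pairSumPath μ K ρ ϑ θ 0 - X₀ - levelPoint μ K e α) -
        frameLevel μ K (pairSumPath μ K ρ ϑ' θ 0 - X₀ - levelPoint μ K e α) ∧
      frameLevel μ K (pairSumPath μ K ρ ϑ θ 0 - X₀ - levelPoint μ K e α) -
        frameLevel μ K (pairSumPath μ K ρ ϑ' θ 0 - X₀ - levelPoint μ K e α) ≤ κ₂ * (ϑ - ϑ') := by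
  set g : ℝ → ℝ := fun t => frameLevel μ K (pairSumPath μ K ρ t θ 0 - X₀ - levelPoint μ K e α) with hg
  have hderiv : ∀ s ∈ Icc ϑ' ϑ, κ₁ ≤ deriv g s ∧ deriv g s ≤ κ₂ := fun s hs => by
    rw [hg, deriv_partnerBand_config hA hd hlo hhi X₀ hρ θ e α s]
    exact hwin s hs
  have hdiff : ∀ s : ℝ, DifferentiableAt ℝ g s := fun s => (hasDerivAt_partnerBand_config hA hd hlo hhi X₀ hρ θ e α s).differentiableAt
  have hcont : ContinuousOn g (Icc ϑ' ϑ) := fun s _ => (hdiff s).continuousAt.continuousWithinAt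
  have hdiff' : DifferentiableOn ℝ g (interior (Icc ϑ' ϑ)) := fun s _ => (hdiff s).differentiableWithinAt
  have hlow := (convex_Icc ϑ' ϑ).mul_sub_le_image_sub_of_le_deriv hcont hdiff' (fun s hs => (hderiv s (interior_subset hs)).1)
    ϑ' (left_mem_Icc.2 hϑ) ϑ (right_mem_Icc.2 hϑ) hϑ
  have hup := (convex_Icc ϑ' ϑ).image_sub_le_mul_sub_of_deriv_le hcont hdiff' (fun s hs => (hderiv s (interior_subset hs)).2)
    ϑ' (left_mem_Icc.2 hϑ) ϑ (right_mem_Icc.2 hϑ) hϑ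
  exact ⟨by simpa [hg] using hlow, by simpa [hg] using hup⟩

/-! ## §5 The same-direction exclusion on umklapp sheets -/

omit hA hd hlo hhi in
/-- Norm bookkeeping: with `P = k + q − p`, `‖k − q − v‖ ≤ ‖P − p − v‖ + 2‖p − q‖` (`k − q − v = (P − p − v) + 2(p − q)`). -/
theorem norm_sub_sub_le_caustic_add_two (k q p P v : Momentum) (hP : P = k + q - p) :
    ‖k - q - v‖ ≤ ‖P - p - v‖ + 2 * ‖p - q‖ := by
  have hid : k - q - v = (P - p - v) + (2 : ℝ) • (p - q) := by
    rw [hP, two_smul]; abel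
  rw [hid]
  refine (norm_add_le _ _).trans ?_
  rw [norm_smul, Real.norm_eq_abs, abs_of_pos (by norm_num : (0 : ℝ) < 2)]

omit hd in
/-- **Two chart points never differ by a nonzero period, with margin 3/5**: `3/5 < ‖Φ(e,α) − Φ(e′,α′) − 2πm‖` for `m ≠ 0` and tube levels `|e|, |e′| < r`
(every chart coordinate has modulus `< π − 3/10`, `…C4aPartnerBandCooperChord.abs_levelPoint_apply_lt`). -/
theorem lt_norm_levelPoint_sub_levelPoint_sub_twoPi {e e' : ℝ} (he : |e| < r) (he' : |e'| < r) (α α' : ℝ) {m : Fin 2 → ℤ} (hm : m ≠ 0) :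
    3 / 5 < ‖levelPoint μ K e α - levelPoint μ K e' α' - WithLp.toLp 2 (fun i => 2 * π * (m i : ℝ))‖ := by
  obtain ⟨i, hi⟩ : ∃ i, m i ≠ 0 := by
    by_contra h
    push Not at h
    exact hm (funext h)
  have hmi : (1 : ℝ) ≤ |(m i : ℝ)| := by
    rw [← Int.cast_abs]; exact_mod_cast Int.one_le_abs hi
  have h1 := abs_levelPoint_apply_lt hA hlo hhi he α i
  have h2 := abs_levelPoint_apply_lt hA hlo hhi he' α' i
  refine lt_of_lt_of_le ?_ (PiLp.norm_apply_le (levelPoint μ K e α - levelPoint μ K e' α' - WithLp.toLp 2 (fun i => 2 * π * (m i : ℝ))) i)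
  rw [PiLp.sub_apply, PiLp.sub_apply, PiLp.toLp_apply, Real.norm_eq_abs]
  obtain ⟨x, hx⟩ : ∃ x : ℝ, x = levelPoint μ K e α i - levelPoint μ K e' α' i := ⟨_, rfl⟩
  rw [← hx]
  have h3 : |x| < 2 * π - 3 / 5 := by
    have := abs_sub (levelPoint μ K e α i) (levelPoint μ K e' α' i)
    rw [hx]; linarith
  have h4 : 2 * π * |(m i : ℝ)| - |x| ≤ |x - 2 * π * (m i : ℝ)| := by
    have h := abs_sub_abs_le_abs_sub (2 * π * (m i : ℝ)) x
    rw [abs_mul, abs_of_pos (by positivity : (0 : ℝ) < 2 * π), abs_sub_comm] at h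
    exact h
  nlinarith [Real.pi_pos, Real.pi_gt_three]

omit hd in
/-- **AN UMKLAPP FOLD POINT IS NEVER `q′`-DIRECTED** (the same-direction half of the degenerate alternative of §3, excluded by the 3/5 margin): for `k = Φ(0,θ)`,
`q′ = Φ(ρ,ϑ+θ)`, any chart point `p = Φ(e,α)` and its partner `P = S − p`, on every sheet `m ≠ 0`:  `3/5 < ‖P − p − 2πm‖ + 2‖p − q′‖`.  So a window on which
`‖P − p − 2πm‖ ≤ ε₁` (near the caustic of sheet `m`) and `‖p − q′‖ ≤ ε₂` with `ε₁ + 2ε₂ ≤ 3/5` is EMPTY. -/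
theorem lt_caustic_dist_add_two_norm_sub (hr : 0 < r) {ρ : ℝ} (hρ : |ρ| < r) (e ϑ θ α : ℝ) {m : Fin 2 → ℤ} (hm : m ≠ 0) :
    3 / 5 < ‖pairSumPath μ K ρ ϑ θ 0 - levelPoint μ K e α - levelPoint μ K e α - WithLp.toLp 2 (fun i => 2 * π * (m i : ℝ))‖ +
      2 * ‖levelPoint μ K e α - levelPoint μ K ρ (ϑ + θ)‖ := by
  have h0 : |(0 : ℝ)| < r := by simpa using hr
  have hk := lt_norm_levelPoint_sub_levelPoint_sub_twoPi hA hlo hhi h0 hρ θ (ϑ + θ) hm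
  have hP : pairSumPath μ K ρ ϑ θ 0 - levelPoint μ K e α = levelPoint μ K 0 θ + levelPoint μ K ρ (ϑ + θ) - levelPoint μ K e α := by
    simp only [pairSumPath, add_zero]
  have h := norm_sub_sub_le_caustic_add_two (levelPoint μ K 0 θ) (levelPoint μ K ρ (ϑ + θ)) (levelPoint μ K e α)
    (pairSumPath μ K ρ ϑ θ 0 - levelPoint μ K e α) (WithLp.toLp 2 (fun i => 2 * π * (m i : ℝ))) hP
  exact lt_of_lt_of_le hk h

end Sizes

end Summit.HubbardSuperconductivity.HubbardSuperconductivity.Theorems.C4a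

end
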